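import Summits.QuantumFields.YangMills.Theorems.BalabanUVNodesN22GenLastCouplingSchemasOfHolo

/-!
# BalabanUVNodes ∕ node N22 = NE9 — ROAD 2 FROM ANALYTICITY ALONE, THE KERNEL-FACE SOCKET AND THE PIN FACE: `∀ k, N22At (u3OfRecord₁₃ θ (objectsOfRecord₁₃ F N θ ℓ) k)`
# (dag-n27-c's `h22` row) and `N22At (rateCarriersOfRecord₁₃CoPH 𝔯 F θ hP g₀ os k).u3` from node N18's kernel step rate + the analytic reading in the older terms + sector
# holomorphy in the last coupling (module J59 §3's inputs)

Cell `pub-ymgap`, HUMAN RULING D-0062 (Track A), R134 seat `pub-ymgap-dag-n22-c` (strategy s1), generation 18, module J60.  THEOREMS ONLY (no `def`, no `sorry`, standard axioms);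
`--kind proof --supports stmt-QuantumFields-27366 --as helper` (K3⁸ `SpineGivenEndpointR13SepCoPHV`), COUNT-NEUTRAL.  Imports module J59 `…N22GenLastCouplingSchemasOfHolo` (through
it J58, J57, J54 and dag-n22-w3's socket ∕ pin forms).  Nothing re-declared; §1–§2 are ONE application of J59 §3 each, with the OUTPUT-BOUND binder `hbd` of J46∕J49∕J52∕J54∕J58∕J59 DISCHARGED by §0 (it is implied by the analytic reading + (Adm-run)).

§0 (ns `YMDAG.N22.TermRecursion`) ★ `outputBound_truncRun_toClusterTower_of_analyticReading` — the printed-type output bound `‖E^{(k+1)}(X; g; φ)‖ ≤ M_b·e^{−κd}` of the run towers FROM (AR-fact) + the ball bound + (AR-adm) + (Adm-run) ([I] (1.18) p. 263 as an OUTPUT of the reading, not an extra input); §1 ★★★ `n22At_u3OfRecord₁₃_of_kernelStepRate_genAnalytic` — the KERNEL-FACE SOCKET on ROAD 2 from analyticity alone (J59 §3's inputs ⟹ `N22At (u3OfRecord₁₃ θ (objectsOfRecord₁₃ F N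
θ ℓ) k)` for every run length `k`, by dag-n22-w3's level-free `n22At_u3OfRecord₁₃_objectsOfRecord₁₃_iff`); §2 ★★★ `n22At_rateCarriers_of_kernels_pin_of_kernelStepRate_genAnalytic` —
the PIN FACE (under K3's node-U3 pin `hpin`, the inputs at `θ.toStage13Params` give `N22At (rateCarriersOfRecord₁₃CoPH 𝔯 F θ hP g₀ os k).u3`).  THE N22 ROW SENTENCE in this
currency: «node N18's kernel step rate of record + ANALYTICITY WITH A MARGIN of def-W1's one-step map — in the older terms read into a Banach space (sup-type reading, age weights
`≤ c_w ω₁^{age}`) and in the complex last coupling on relative discs with quadratic centring — + generated runs admissible (the output bound then follows, §0) + term holomorphy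
through the readings + tails + W1-20's law at the run towers + (1.21) + letter rows with `ℓ.θ₅·ν ≤ ℓ.ω²`, `ν > ω₁ + 4M_b c_w∕ϱ`, `ν ≥ (ω₁ + 4M_b c_w∕ϱ)²` ⇒ §2b `h9` ∕ `N22At`».

HONEST FRAMING (binding).  Count-neutral COMPOSITION; every input a DISPLAYED HYPOTHESIS (the analytic reading and the sector datum are the cell's readings of [II] (2.14)–(2.15)
p. 15 and [I] p. 263 ∕ p. 266, NOT printed as such — GAPS G-ne9p2-5, G-t4-U3-1∕-3; producer: node N09 ∕ N10 ∕ NODE A on def-T's generator of record; inhabited by every generator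
constant in `(z, old)` — A5, conditional content); NO estimate of Bałaban's is proved or asserted; nothing of the record is constructed or claimed to meet the displayed inputs.
N22 is NOT discharged (typed 28∕28 · discharged 5∕27 UNCHANGED); K3⁸ OPEN and NOT claimed (no stub of 27366 touched); NE9 is NOT IN PRINT for d = 4; no count claim; one finite
𝕋⁴ programme at fixed ε — R4 closes the CONDITIONAL rung `BalabanLadder.UV` only; NOTHING about the continuum limit, ℝ⁴, infinite volume, OS axioms, a mass gap or the Clay problem
is proved or claimed.  References (TYPES only): [I] = Bałaban, CMP 109 (1987) (0.23) p. 256, §1 p. 263, p. 266, (2.12)–(2.13) p. 268, p. 282, §5 p. 298; [II] = CMP 116 (1988)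
(1.41) p. 11, (2.13)–(2.15) pp. 14–15, p. 18, (2.41) p. 21; King, CMP 102 (1986) Lemma 4.5 (4.38).
-/

noncomputable section

open Set Metric
open scoped BigOperators

namespace YMDAG.N22.TermRecursion

open Literature.MathematicalPhysics.QuantumFieldTheory.Balaban1983to89
open Literature.MathematicalPhysics.QuantumFieldTheory.Balaban1983to89.T4OutputRate (Window)
open Literature.MathematicalPhysics.QuantumFieldTheory.Balaban1983to89.Node00.Sect2 (domSys CPair)
open Literature.MathematicalPhysics.QuantumFieldTheory.Balaban1983to89.Node00.W1
open Literature.MathematicalPhysics.QuantumFieldTheory.Balaban1983to89.Node00.U3OfKernels (histPrefix)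

/-! ## §0 ★ The output bound of the run towers from the analytic reading -/
section Gen

variable {P : Params} {𝔸 : Type} {M : ℕ} (G : GenTower P 𝔸 M) (sp : (k : ℕ) → (domSys P M (k + 1)).Dom → Set (CPair P 𝔸))
  (Adm : (k : ℕ) → OlderTerms P 𝔸 M k → Prop)
  {Pot : ℕ → Type*} [∀ k, NormedAddCommGroup (Pot k)] [∀ k, NormedSpace ℂ (Pot k)]
  (ρ : (k : ℕ) → OlderTerms P 𝔸 M k → Pot k) (A : (k : ℕ) → ℝ → CPair P 𝔸 → (domSys P M (k + 1)).Dom → Pot k → ℂ)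

omit [∀ k, NormedSpace ℂ (Pot k)] in
/-- ★ **THE OUTPUT BOUND OF THE RUN TOWERS IS IMPLIED BY THE ANALYTIC READING + (Adm-run)**: (AR-fact) on `Adm k`, the bound `‖A k t φ X‖ ≤ M_b·e^{−κd}` on `ball 0 R`, admissible
families read into `closedBall 0 r₀` (`r₀ < R`) and the generated older-term families admissible along the window ⟹ for every window history `g`, run length `K`, step `k`, domain
`X` and admissible `φ`: **`‖(truncRun K (toClusterTower G) k).E (g₀,…,g_k) φ X‖ ≤ M_b·e^{−κ d_{k+1}(X)}`** — the step datum of the generated tower IS the one-step map at the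
generated older terms (`termC_succ`, `termC_toClusterTower`, `recTerm_succ`); beyond the run the step is termless (`E_termlessTower`).  So the binder `hbd` of modules
J46∕J49∕J52∕J54∕J58 is REDUNDANT in the analytic-reading currency. [folklore] -/
theorem outputBound_truncRun_toClusterTower_of_analyticReading {γ κ R r₀ Mb : ℝ} (hr₀R : r₀ < R) (hMb0 : 0 ≤ Mb)
    (hGA : ∀ (k : ℕ), ∀ t ∈ Ioc (0 : ℝ) γ, ∀ (old : OlderTerms P 𝔸 M k), Adm k old → ∀ (X : (domSys P M (k + 1)).Dom), ∀ φ ∈ sp k X,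
      (G k).E ((t : ℝ) : ℂ) old φ X = A k t φ X (ρ k old))
    (hMb : ∀ (k : ℕ), ∀ t ∈ Ioc (0 : ℝ) γ, ∀ (X : (domSys P M (k + 1)).Dom), ∀ φ ∈ sp k X, ∀ p ∈ ball (0 : Pot k) R,
      ‖A k t φ X p‖ ≤ Mb * Real.exp (-(κ * (domSys P M (k + 1)).dj X)))
    (hAdmr : ∀ (k : ℕ) (old : OlderTerms P 𝔸 M k), Adm k old → ‖ρ k old‖ ≤ r₀)
    (hAdm : ∀ g ∈ Window γ, ∀ k, Adm k (olderOf (recTerm G fun n => ((g n : ℝ) : ℂ)) k)) (K : ℕ) :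
    ∀ g ∈ Window γ, ∀ (k : ℕ) (X : (domSys P M (k + 1)).Dom), ∀ φ ∈ sp k X,
      ‖(truncRun K (toClusterTower G) k).E (histPrefix g k) φ X‖ ≤ Mb * Real.exp (-(κ * (domSys P M (k + 1)).dj X)) := by
  intro g hg k X φ hφ
  by_cases hk : k < K
  · rw [truncRun_of_lt _ hk, show histPrefix g k = restrictPrefix k g from rfl, ← termC_succ, termC_toClusterTower, recTerm_succ,
      hGA k (g k) (hg k) _ (hAdm g hg k) X φ hφ]
    exact hMb k (g k) (hg k) X φ hφ _ (mem_ball_zero_iff.mpr ((hAdmr k _ (hAdm g hg k)).trans_lt hr₀R))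
  · rw [truncRun_of_le _ (Nat.not_lt.mp hk), E_termlessTower, norm_zero]
    positivity

end Gen

end YMDAG.N22.TermRecursion

namespace YMDAG.N22.KernelFading

open Literature.MathematicalPhysics.QuantumFieldTheory.Balaban1983to89
open Literature.MathematicalPhysics.QuantumFieldTheory.Balaban1983to89.T4Continuum (T4Family ULoop)
open Literature.MathematicalPhysics.QuantumFieldTheory.Balaban1983to89.T4OutputRate (Window NE9)
open Literature.MathematicalPhysics.QuantumFieldTheory.Balaban1983to89.TreeLengthTorus (TPt)
open Literature.MathematicalPhysics.QuantumFieldTheory.Balaban1983to89.B12TreeDecay (K₀ kappa₀)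
open Literature.MathematicalPhysics.QuantumFieldTheory.Balaban1983to89.B12Decay510 (delta1)
open Literature.MathematicalPhysics.QuantumFieldTheory.Balaban1983to89.B12Decay510Window (K₁)
open Literature.MathematicalPhysics.QuantumFieldTheory.Balaban1983to89.B12Decay510Torus (distCT nearT)
open Literature.MathematicalPhysics.QuantumFieldTheory.Balaban1983to89.Node00 (Stage13Params Stage13HParams U3Letters₁₁ MatA)
open Literature.MathematicalPhysics.QuantumFieldTheory.Balaban1983to89.Node00.Sect2 (domSys domCount CPair)
open Literature.MathematicalPhysics.QuantumFieldTheory.Balaban1983to89.Node00.W1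
open Literature.MathematicalPhysics.QuantumFieldTheory.Balaban1983to89.Node00.LocalizedSum17 (ReadingMaps Localizes17OfRecord₁₃)
open Literature.MathematicalPhysics.QuantumFieldTheory.Balaban1983to89.Node00.U3OfKernels (histPrefix objectsOfRecord₁₃)
open Literature.MathematicalPhysics.QuantumFieldTheory.Balaban1983to89.Node00.U3KernelLetters (KernelStepRateOfRecord₁₃ PolLimitsExistOfRecord₁₃)
open YMDAG.UVSplit (N22At u3OfRecord₁₃ RateReading₁₃CoPH rateCarriersOfRecord₁₃CoPH)
open YMDAG.N22.AtKernels (n22At_rateCarriers_of_kernels_pin_of_ne9 n22At_u3OfRecord₁₃_objectsOfRecord₁₃_iff)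
open YMDAG.N22.TermRecursion (genT1last_of_lastSectorHolo genT2last_of_lastSectorHolo outputBound_truncRun_toClusterTower_of_analyticReading)

open scoped Matrix.Norms.L2Operator

variable (F : T4Family) (N : ℕ) [NeZero N] {𝔸 : Type} {M : ℕ}

/-! ## §1 ★★★ The kernel-face socket on ROAD 2 from analyticity alone -/

open Classical Finset in
/-- ★★★ **THE KERNEL-FACE SOCKET ON ROAD 2 FROM ANALYTICITY ALONE** — module J59 §3's inputs ⟹ **`N22At (u3OfRecord₁₃ θ (objectsOfRecord₁₃ F N θ ℓ) k)` for EVERY run length `k`**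
(dag-n27-c's `h22` row of the `…KernelFaces` leaves), by dag-n22-w3's level-free `n22At_u3OfRecord₁₃_objectsOfRecord₁₃_iff` on J58 §1 fed with J59 §2.  LOCATED (hypothesis
form); N22 NOT discharged. [folklore] -/
theorem n22At_u3OfRecord₁₃_of_kernelStepRate_genAnalytic (θ : Stage13Params F N) (ℓ : U3Letters₁₁) (hs : ℓ.Signs) (hγ : 0 < θ.γ)
    (hlim : PolLimitsExistOfRecord₁₃ F N θ) {κ₅ C₅ : ℝ} (hC₅ : 0 ≤ C₅) (h5 : KernelStepRateOfRecord₁₃ F N θ κ₅ ℓ.θ₅ C₅)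
    (m' : ℕ) (M : ℕ) [NeZero M] (hM : M = F.L ^ m')
    (Gn : (K : ℕ) → GenTower (F.P K) 𝔸 M) (emb : ReadingMaps F (MatA N) 𝔸)
    (hloc : Localizes17OfRecord₁₃ F N θ (fun K => truncRun K (toClusterTower (Gn K))) emb)
    (sp : (K k : ℕ) → (domSys (F.P K) M (k + 1)).Dom → Set (CPair (F.P K) 𝔸))
    {κ κE δ₀ B₃ r R r₀ ϱ Mb cw ω₁ ν cS Bq : ℝ} {aw : ℕ → ℕ → ℕ → ℝ}
    (hκ₀ : kappa₀ (4 * 2 ^ 4) (2 * 4) ≤ κ / 2) (hδ₀ : 0 < δ₀) (hB₃ : 0 ≤ B₃) (hr : 0 < r) (hκE : κ ≤ κE)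
    (Adm : (K k : ℕ) → OlderTerms (F.P K) 𝔸 M k → Prop)
    (hAdm : ∀ K, ∀ g ∈ Window θ.γ, ∀ k, Adm K k (olderOf (recTerm (Gn K) fun n => ((g n : ℝ) : ℂ)) k))
    {Pot : ℕ → ℕ → Type*} [∀ K k, NormedAddCommGroup (Pot K k)] [∀ K k, NormedSpace ℂ (Pot K k)]
    (ρA : (K k : ℕ) → OlderTerms (F.P K) 𝔸 M k → Pot K k) (A : (K k : ℕ) → ℝ → CPair (F.P K) 𝔸 → (domSys (F.P K) M (k + 1)).Dom → Pot K k → ℂ)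
    (hGA : ∀ (K k : ℕ), ∀ t ∈ Ioc (0 : ℝ) θ.γ, ∀ (old : OlderTerms (F.P K) 𝔸 M k), Adm K k old → ∀ (X : (domSys (F.P K) M (k + 1)).Dom), ∀ φ ∈ sp K k X,
      ((Gn K) k).E ((t : ℝ) : ℂ) old φ X = A K k t φ X (ρA K k old))
    (hA : ∀ (K k : ℕ), ∀ t ∈ Ioc (0 : ℝ) θ.γ, ∀ (X : (domSys (F.P K) M (k + 1)).Dom), ∀ φ ∈ sp K k X, DifferentiableOn ℂ (A K k t φ X) (ball 0 R))
    (hMbA : ∀ (K k : ℕ), ∀ t ∈ Ioc (0 : ℝ) θ.γ, ∀ (X : (domSys (F.P K) M (k + 1)).Dom), ∀ φ ∈ sp K k X, ∀ p ∈ ball (0 : Pot K k) R,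
      ‖A K k t φ X p‖ ≤ Mb * Real.exp (-(κE * (domSys (F.P K) M (k + 1)).dj X)))
    (hAdmr : ∀ (K k : ℕ) (old : OlderTerms (F.P K) 𝔸 M k), Adm K k old → ‖ρA K k old‖ ≤ r₀)
    (hρ₁ : ∀ (K k : ℕ) (o o' : OlderTerms (F.P K) 𝔸 M k), Adm K k o → Adm K k o' → ∀ (B' : ℝ), 0 ≤ B' →
      (∀ (k' : ℕ) (hk' : k' < k) (Y : (domSys (F.P K) M (k' + 1)).Dom), ∀ φ' ∈ sp K k' Y,
        aw K k (k' + 1) * (Real.exp (κE * (domSys (F.P K) M (k' + 1)).dj Y) * ‖o ⟨k' + 1, Nat.succ_lt_succ hk'⟩ Y φ' - o' ⟨k' + 1, Nat.succ_lt_succ hk'⟩ Y φ'‖) ≤ B') →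
      ‖ρA K k o - ρA K k o'‖ ≤ B')
    (hρ₂ : ∀ (K k : ℕ) (o₁ o₂ o₃ : OlderTerms (F.P K) 𝔸 M k), Adm K k o₁ → Adm K k o₂ → Adm K k o₃ → ∀ (B' : ℝ), 0 ≤ B' →
      (∀ (k' : ℕ) (hk' : k' < k) (Y : (domSys (F.P K) M (k' + 1)).Dom), ∀ φ' ∈ sp K k' Y,
        aw K k (k' + 1) * (Real.exp (κE * (domSys (F.P K) M (k' + 1)).dj Y) *
          ‖o₁ ⟨k' + 1, Nat.succ_lt_succ hk'⟩ Y φ' - 2 * o₂ ⟨k' + 1, Nat.succ_lt_succ hk'⟩ Y φ' + o₃ ⟨k' + 1, Nat.succ_lt_succ hk'⟩ Y φ'‖) ≤ B') →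
      ‖ρA K k o₁ - (2 : ℂ) • ρA K k o₂ + ρA K k o₃‖ ≤ B')
    (haw : ∀ K k j, 0 ≤ aw K k j) (haw0 : ∀ K k, aw K k 0 = 0) (hawω : ∀ K k j, j ≤ k → aw K k j ≤ cw * ω₁ ^ (k - j)) (hcw : 0 ≤ cw)
    (hMb0 : 0 ≤ Mb) (hϱ : 0 < ϱ) (hR : r₀ + ϱ < R)
    (O : ℕ → Set ℂ) (V : (K k : ℕ) → OlderTerms (F.P K) 𝔸 M k → CPair (F.P K) 𝔸 → (domSys (F.P K) M (k + 1)).Dom → ℂ) (hcS : 0 < cS) (hBq : 0 ≤ Bq)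
    (hballS : ∀ K, ∀ s ∈ Ioc (0 : ℝ) θ.γ, closedBall (s : ℂ) (cS * s) ⊆ O K)
    (hholS : ∀ (K k : ℕ) (old : OlderTerms (F.P K) 𝔸 M k), Adm K k old → ∀ (X : (domSys (F.P K) M (k + 1)).Dom), ∀ φ ∈ sp K k X,
      DifferentiableOn ℂ (fun z => ((Gn K) k).E z old φ X) (O K))
    (hbdS : ∀ (K k : ℕ) (old : OlderTerms (F.P K) 𝔸 M k), Adm K k old → ∀ (X : (domSys (F.P K) M (k + 1)).Dom), ∀ φ ∈ sp K k X, ∀ s ∈ Ioc (0 : ℝ) θ.γ,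
      ∀ z ∈ closedBall (s : ℂ) (cS * s), ‖((Gn K) k).E z old φ X - V K k old φ X‖ ≤ Bq * Real.exp (-(κE * (domSys (F.P K) M (k + 1)).dj X)) * s ^ 2)
    (hω₁ : 0 ≤ ω₁) (hω₁1 : ω₁ ≤ 1) (hν : ω₁ + 4 * Mb * cw / ϱ < ν)
    (hμν : (ω₁ + 4 * Mb * cw / ϱ) ^ 2 ≤ ν) (hν1 : 1 ≤ ν)
    (Ec : ℕ → ℕ → Type*) [∀ K k, NormedAddCommGroup (Ec K k)] [∀ K k, NormedSpace ℂ (Ec K k)]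
    (ι : letI := θ.instVβ₁; letI := θ.instVβ₂
      (K k : ℕ) → (domSys (F.P K) M (k + 1)).Dom → ((Fin (F.P K).d → Site (F.P K) (k + 1) → θ.Vβ) →L[ℝ] Ec K k))
    (Φ : (K k : ℕ) → (domSys (F.P K) M (k + 1)).Dom → Ec K k → CPair (F.P K) 𝔸)
    (U : (K k : ℕ) → (domSys (F.P K) M (k + 1)).Dom → Set (Ec K k)) (hU : ∀ K k X, IsOpen (U K k X)) (hrU : ∀ K k X, ball (0 : Ec K k) r ⊆ U K k X)
    (hEhol : ∀ g ∈ Window θ.γ, ∀ (K k : ℕ) (X : (domSys (F.P K) M (k + 1)).Dom),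
      DifferentiableOn ℂ (fun z => (truncRun K (toClusterTower (Gn K)) k).E (histPrefix g k) (Φ K k X z) X) (U K k X))
    (hΦemb : letI := θ.instVβ₁; letI := θ.instVβ₂
      ∀ (K k : ℕ) (X : (domSys (F.P K) M (k + 1)).Dom) (Bf : Fin (F.P K).d → Site (F.P K) (k + 1) → θ.Vβ),
        Φ K k X (ι K k X Bf) = emb K k (fun l t => NormedSpace.exp (θ.ρ8 (Bf l t))))
    (hΦsp : ∀ (K k : ℕ) (X : (domSys (F.P K) M (k + 1)).Dom), ∀ z ∈ ball (0 : Ec K k) r, Φ K k X z ∈ sp K k X)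
    (w : (K k : ℕ) → (domSys (F.P K) M (k + 1)).Dom → Site (F.P K) (k + 1) → ℝ) (hw₀ : ∀ K k X t, 0 ≤ w K k X t)
    (hw : letI := θ.instVβ₁; letI := θ.instVβ₂; letI := θ.instιβ
      ∀ (K k : ℕ) (X : (domSys (F.P K) M (k + 1)).Dom) (l : Fin (F.P K).d) (t : Site (F.P K) (k + 1)) (c : θ.ιβ),
        ‖ι K k X (Pi.single l (Pi.single t (θ.bV c)))‖ ≤ w K k X t)
    (htail : ∀ (K k : ℕ) (X : (domSys (F.P K) M (k + 1)).Dom) (t : Site (F.P K) (k + 1)),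
      let e : Site (F.P K) (k + 1) → TPt 4 (domCount (F.P K) M (k + 1) * M) := fun x i => (ZMod.cast (x i) : ZMod (domCount (F.P K) M (k + 1) * M))
      w K k X t ≤ B₃ * Real.exp (-δ₀ * distCT (domCount (F.P K) M (k + 1)) M (e t) (nearT (M := M) (e t) X)))
    (hκ₅ : delta1 δ₀ κ ((M : ℝ) * 4) ≤ κ₅)
    (hω : 0 < ℓ.ω) (hθω : ℓ.θ₅ * ν ≤ ℓ.ω ^ 2) (hℓκ : ℓ.κ ≤ delta1 δ₀ κ ((M : ℝ) * 4))
    (hC₉ : (4 * (2 * C₅ / (1 - ℓ.θ₅) + 2 * ((16 * Mb * B₃ ^ 2 / r ^ 2) * Real.exp (delta1 δ₀ κ ((M : ℝ) * 4) * ((M : ℝ) * 4) * 3) * K₀ (4 * 2 ^ 4) (2 * 4) * K₁ 4 (δ₀ / 2))) / θ.γ +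
        ((16 * max ((6 * cS ^ 2 + 32 * cS + 64) / cS ^ 2 * Bq) (64 * Mb * cw ^ 2 / ϱ ^ 2 * (Bq * θ.γ / cS) ^ 2 / (ν - ω₁ - 4 * Mb * cw / ϱ)) * B₃ ^ 2 / r ^ 2) * Real.exp (delta1 δ₀ κ ((M : ℝ) * 4) * ((M : ℝ) * 4) * 3) * K₀ (4 * 2 ^ 4) (2 * 4) *
          K₁ 4 (δ₀ / 2)) * θ.γ / 2) / ℓ.ω ≤ ℓ.C₉) (k : ℕ) :
    N22At (u3OfRecord₁₃ θ (objectsOfRecord₁₃ F N θ ℓ) k) :=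
  (n22At_u3OfRecord₁₃_objectsOfRecord₁₃_iff F N θ ℓ hs k).2
    (ne9_EA_objectsOfRecord₁₃_of_kernelStepRate_genAnalyticReading F N θ ℓ hs hγ hlim hC₅ h5 m' M hM Gn emb hloc sp hκ₀ hδ₀ hB₃ hr hMb0 hκE Adm hAdm ρA A hGA hA hMbA
      hAdmr hρ₁ hρ₂ haw haw0 hawω hcw hMb0 hϱ hR (lam := fun _ _ => Bq * θ.γ / cS) (lam₂ := fun _ _ => (6 * cS ^ 2 + 32 * cS + 64) / cS ^ 2 * Bq)
      (fun K => genT1last_of_lastSectorHolo (Gn K) (sp K) (Adm K) (V K) hcS hBq (hballS K) (hholS K) (hbdS K)) (fun _ _ => le_rfl) (by positivity)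
      (fun K => genT2last_of_lastSectorHolo (Gn K) (sp K) (Adm K) (V K) hcS hBq (hballS K) (hholS K) (hbdS K)) (fun _ _ => le_rfl) (by positivity) hω₁ hω₁1 hν hμν hν1
      (fun g hg K => outputBound_truncRun_toClusterTower_of_analyticReading (Gn K) (sp K) (Adm K) (ρA K) (A K) (by linarith) hMb0 (hGA K) (hMbA K) (hAdmr K)
        (hAdm K) K g hg) Ec ι Φ U hU hrU hEhol hΦemb hΦsp w hw₀ hw htail hκ₅ hω hθω hℓκ hC₉)

/-! ## §2 ★★★ The N22 pin face on ROAD 2 from analyticity alone -/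

open Classical Finset in
/-- ★★★ **THE N22 PIN FACE ON ROAD 2 FROM ANALYTICITY ALONE**: under K3's node-U3 pin at the tuple (`hpin`), J59 §3's inputs at `θ.toStage13Params` give
`N22At (rateCarriersOfRecord₁₃CoPH 𝔯 F θ hP g₀ os k).u3` for EVERY run length `k` — dag-n22-w3's pin form on J58 §1 fed with J59 §2.  LOCATED (hypothesis form); N22 NOT
discharged. [folklore] -/
theorem n22At_rateCarriers_of_kernels_pin_of_kernelStepRate_genAnalytic (𝔯 : RateReading₁₃CoPH N) (θ : Stage13HParams F N) (hP : θ.Provisos₁₃CoPH F N)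
    (g₀ : ℕ → ℝ) (os : List (ULoop F)) (ℓ : U3Letters₁₁) (hs : ℓ.Signs) (hγ : 0 < θ.γ)
    (hpin : (𝔯.lit F θ hP g₀ os).u3 = objectsOfRecord₁₃ F N θ.toStage13Params ℓ)
    (hlim : PolLimitsExistOfRecord₁₃ F N θ.toStage13Params) {κ₅ C₅ : ℝ} (hC₅ : 0 ≤ C₅) (h5 : KernelStepRateOfRecord₁₃ F N θ.toStage13Params κ₅ ℓ.θ₅ C₅)
    (m' : ℕ) (M : ℕ) [NeZero M] (hM : M = F.L ^ m')
    (Gn : (K : ℕ) → GenTower (F.P K) 𝔸 M) (emb : ReadingMaps F (MatA N) 𝔸) (hloc : Localizes17OfRecord₁₃ F N θ.toStage13Params (fun K => truncRun K (toClusterTower (Gn K))) emb)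
    (sp : (K k : ℕ) → (domSys (F.P K) M (k + 1)).Dom → Set (CPair (F.P K) 𝔸))
    {κ κE δ₀ B₃ r R r₀ ϱ Mb cw ω₁ ν cS Bq : ℝ} {aw : ℕ → ℕ → ℕ → ℝ}
    (hκ₀ : kappa₀ (4 * 2 ^ 4) (2 * 4) ≤ κ / 2) (hδ₀ : 0 < δ₀) (hB₃ : 0 ≤ B₃) (hr : 0 < r) (hκE : κ ≤ κE)
    (Adm : (K k : ℕ) → OlderTerms (F.P K) 𝔸 M k → Prop)
    (hAdm : ∀ K, ∀ g ∈ Window θ.γ, ∀ k, Adm K k (olderOf (recTerm (Gn K) fun n => ((g n : ℝ) : ℂ)) k))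
    {Pot : ℕ → ℕ → Type*} [∀ K k, NormedAddCommGroup (Pot K k)] [∀ K k, NormedSpace ℂ (Pot K k)]
    (ρA : (K k : ℕ) → OlderTerms (F.P K) 𝔸 M k → Pot K k) (A : (K k : ℕ) → ℝ → CPair (F.P K) 𝔸 → (domSys (F.P K) M (k + 1)).Dom → Pot K k → ℂ)
    (hGA : ∀ (K k : ℕ), ∀ t ∈ Ioc (0 : ℝ) θ.γ, ∀ (old : OlderTerms (F.P K) 𝔸 M k), Adm K k old → ∀ (X : (domSys (F.P K) M (k + 1)).Dom), ∀ φ ∈ sp K k X,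
      ((Gn K) k).E ((t : ℝ) : ℂ) old φ X = A K k t φ X (ρA K k old))
    (hA : ∀ (K k : ℕ), ∀ t ∈ Ioc (0 : ℝ) θ.γ, ∀ (X : (domSys (F.P K) M (k + 1)).Dom), ∀ φ ∈ sp K k X, DifferentiableOn ℂ (A K k t φ X) (ball 0 R))
    (hMbA : ∀ (K k : ℕ), ∀ t ∈ Ioc (0 : ℝ) θ.γ, ∀ (X : (domSys (F.P K) M (k + 1)).Dom), ∀ φ ∈ sp K k X, ∀ p ∈ ball (0 : Pot K k) R,
      ‖A K k t φ X p‖ ≤ Mb * Real.exp (-(κE * (domSys (F.P K) M (k + 1)).dj X)))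
    (hAdmr : ∀ (K k : ℕ) (old : OlderTerms (F.P K) 𝔸 M k), Adm K k old → ‖ρA K k old‖ ≤ r₀)
    (hρ₁ : ∀ (K k : ℕ) (o o' : OlderTerms (F.P K) 𝔸 M k), Adm K k o → Adm K k o' → ∀ (B' : ℝ), 0 ≤ B' →
      (∀ (k' : ℕ) (hk' : k' < k) (Y : (domSys (F.P K) M (k' + 1)).Dom), ∀ φ' ∈ sp K k' Y,
        aw K k (k' + 1) * (Real.exp (κE * (domSys (F.P K) M (k' + 1)).dj Y) * ‖o ⟨k' + 1, Nat.succ_lt_succ hk'⟩ Y φ' - o' ⟨k' + 1, Nat.succ_lt_succ hk'⟩ Y φ'‖) ≤ B') →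
      ‖ρA K k o - ρA K k o'‖ ≤ B')
    (hρ₂ : ∀ (K k : ℕ) (o₁ o₂ o₃ : OlderTerms (F.P K) 𝔸 M k), Adm K k o₁ → Adm K k o₂ → Adm K k o₃ → ∀ (B' : ℝ), 0 ≤ B' →
      (∀ (k' : ℕ) (hk' : k' < k) (Y : (domSys (F.P K) M (k' + 1)).Dom), ∀ φ' ∈ sp K k' Y,
        aw K k (k' + 1) * (Real.exp (κE * (domSys (F.P K) M (k' + 1)).dj Y) *
          ‖o₁ ⟨k' + 1, Nat.succ_lt_succ hk'⟩ Y φ' - 2 * o₂ ⟨k' + 1, Nat.succ_lt_succ hk'⟩ Y φ' + o₃ ⟨k' + 1, Nat.succ_lt_succ hk'⟩ Y φ'‖) ≤ B') →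
      ‖ρA K k o₁ - (2 : ℂ) • ρA K k o₂ + ρA K k o₃‖ ≤ B')
    (haw : ∀ K k j, 0 ≤ aw K k j) (haw0 : ∀ K k, aw K k 0 = 0) (hawω : ∀ K k j, j ≤ k → aw K k j ≤ cw * ω₁ ^ (k - j)) (hcw : 0 ≤ cw)
    (hMb0 : 0 ≤ Mb) (hϱ : 0 < ϱ) (hR : r₀ + ϱ < R)
    (O : ℕ → Set ℂ) (V : (K k : ℕ) → OlderTerms (F.P K) 𝔸 M k → CPair (F.P K) 𝔸 → (domSys (F.P K) M (k + 1)).Dom → ℂ) (hcS : 0 < cS) (hBq : 0 ≤ Bq)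
    (hballS : ∀ K, ∀ s ∈ Ioc (0 : ℝ) θ.γ, closedBall (s : ℂ) (cS * s) ⊆ O K)
    (hholS : ∀ (K k : ℕ) (old : OlderTerms (F.P K) 𝔸 M k), Adm K k old → ∀ (X : (domSys (F.P K) M (k + 1)).Dom), ∀ φ ∈ sp K k X,
      DifferentiableOn ℂ (fun z => ((Gn K) k).E z old φ X) (O K))
    (hbdS : ∀ (K k : ℕ) (old : OlderTerms (F.P K) 𝔸 M k), Adm K k old → ∀ (X : (domSys (F.P K) M (k + 1)).Dom), ∀ φ ∈ sp K k X, ∀ s ∈ Ioc (0 : ℝ) θ.γ,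
      ∀ z ∈ closedBall (s : ℂ) (cS * s), ‖((Gn K) k).E z old φ X - V K k old φ X‖ ≤ Bq * Real.exp (-(κE * (domSys (F.P K) M (k + 1)).dj X)) * s ^ 2)
    (hω₁ : 0 ≤ ω₁) (hω₁1 : ω₁ ≤ 1) (hν : ω₁ + 4 * Mb * cw / ϱ < ν)
    (hμν : (ω₁ + 4 * Mb * cw / ϱ) ^ 2 ≤ ν) (hν1 : 1 ≤ ν)
    (Ec : ℕ → ℕ → Type*) [∀ K k, NormedAddCommGroup (Ec K k)] [∀ K k, NormedSpace ℂ (Ec K k)]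
    (ι : letI := θ.instVβ₁; letI := θ.instVβ₂
      (K k : ℕ) → (domSys (F.P K) M (k + 1)).Dom → ((Fin (F.P K).d → Site (F.P K) (k + 1) → θ.Vβ) →L[ℝ] Ec K k))
    (Φ : (K k : ℕ) → (domSys (F.P K) M (k + 1)).Dom → Ec K k → CPair (F.P K) 𝔸)
    (U : (K k : ℕ) → (domSys (F.P K) M (k + 1)).Dom → Set (Ec K k)) (hU : ∀ K k X, IsOpen (U K k X)) (hrU : ∀ K k X, ball (0 : Ec K k) r ⊆ U K k X)
    (hEhol : ∀ g ∈ Window θ.γ, ∀ (K k : ℕ) (X : (domSys (F.P K) M (k + 1)).Dom),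
      DifferentiableOn ℂ (fun z => (truncRun K (toClusterTower (Gn K)) k).E (histPrefix g k) (Φ K k X z) X) (U K k X))
    (hΦemb : letI := θ.instVβ₁; letI := θ.instVβ₂
      ∀ (K k : ℕ) (X : (domSys (F.P K) M (k + 1)).Dom) (Bf : Fin (F.P K).d → Site (F.P K) (k + 1) → θ.Vβ),
        Φ K k X (ι K k X Bf) = emb K k (fun l t => NormedSpace.exp (θ.ρ8 (Bf l t))))
    (hΦsp : ∀ (K k : ℕ) (X : (domSys (F.P K) M (k + 1)).Dom), ∀ z ∈ ball (0 : Ec K k) r, Φ K k X z ∈ sp K k X)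
    (w : (K k : ℕ) → (domSys (F.P K) M (k + 1)).Dom → Site (F.P K) (k + 1) → ℝ) (hw₀ : ∀ K k X t, 0 ≤ w K k X t)
    (hw : letI := θ.instVβ₁; letI := θ.instVβ₂; letI := θ.instιβ
      ∀ (K k : ℕ) (X : (domSys (F.P K) M (k + 1)).Dom) (l : Fin (F.P K).d) (t : Site (F.P K) (k + 1)) (c : θ.ιβ),
        ‖ι K k X (Pi.single l (Pi.single t (θ.bV c)))‖ ≤ w K k X t)
    (htail : ∀ (K k : ℕ) (X : (domSys (F.P K) M (k + 1)).Dom) (t : Site (F.P K) (k + 1)),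
      let e : Site (F.P K) (k + 1) → TPt 4 (domCount (F.P K) M (k + 1) * M) := fun x i => (ZMod.cast (x i) : ZMod (domCount (F.P K) M (k + 1) * M))
      w K k X t ≤ B₃ * Real.exp (-δ₀ * distCT (domCount (F.P K) M (k + 1)) M (e t) (nearT (M := M) (e t) X)))
    (hκ₅ : delta1 δ₀ κ ((M : ℝ) * 4) ≤ κ₅)
    (hω : 0 < ℓ.ω) (hθω : ℓ.θ₅ * ν ≤ ℓ.ω ^ 2) (hℓκ : ℓ.κ ≤ delta1 δ₀ κ ((M : ℝ) * 4))
    (hC₉ : (4 * (2 * C₅ / (1 - ℓ.θ₅) + 2 * ((16 * Mb * B₃ ^ 2 / r ^ 2) * Real.exp (delta1 δ₀ κ ((M : ℝ) * 4) * ((M : ℝ) * 4) * 3) * K₀ (4 * 2 ^ 4) (2 * 4) * K₁ 4 (δ₀ / 2))) / θ.γ +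
        ((16 * max ((6 * cS ^ 2 + 32 * cS + 64) / cS ^ 2 * Bq) (64 * Mb * cw ^ 2 / ϱ ^ 2 * (Bq * θ.γ / cS) ^ 2 / (ν - ω₁ - 4 * Mb * cw / ϱ)) * B₃ ^ 2 / r ^ 2) * Real.exp (delta1 δ₀ κ ((M : ℝ) * 4) * ((M : ℝ) * 4) * 3) * K₀ (4 * 2 ^ 4) (2 * 4) *
          K₁ 4 (δ₀ / 2)) * θ.γ / 2) / ℓ.ω ≤ ℓ.C₉) (k : ℕ) :
    N22At (rateCarriersOfRecord₁₃CoPH 𝔯 F θ hP g₀ os k).u3 :=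
  n22At_rateCarriers_of_kernels_pin_of_ne9 𝔯 θ hP g₀ os ℓ hs hpin
    (ne9_EA_objectsOfRecord₁₃_of_kernelStepRate_genAnalyticReading F N θ.toStage13Params ℓ hs hγ hlim hC₅ h5 m' M hM Gn emb hloc sp hκ₀ hδ₀ hB₃ hr hMb0 hκE Adm hAdm ρA A hGA hA hMbA
      hAdmr hρ₁ hρ₂ haw haw0 hawω hcw hMb0 hϱ hR (lam := fun _ _ => Bq * θ.γ / cS) (lam₂ := fun _ _ => (6 * cS ^ 2 + 32 * cS + 64) / cS ^ 2 * Bq)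
      (fun K => genT1last_of_lastSectorHolo (Gn K) (sp K) (Adm K) (V K) hcS hBq (hballS K) (hholS K) (hbdS K)) (fun _ _ => le_rfl) (by positivity)
      (fun K => genT2last_of_lastSectorHolo (Gn K) (sp K) (Adm K) (V K) hcS hBq (hballS K) (hholS K) (hbdS K)) (fun _ _ => le_rfl) (by positivity) hω₁ hω₁1 hν hμν hν1
      (fun g hg K => outputBound_truncRun_toClusterTower_of_analyticReading (Gn K) (sp K) (Adm K) (ρA K) (A K) (by linarith) hMb0 (hGA K) (hMbA K) (hAdmr K)
        (hAdm K) K g hg) Ec ι Φ U hU hrU hEhol hΦemb hΦsp w hw₀ hw htail hκ₅ hω hθω hℓκ hC₉) k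

end YMDAG.N22.KernelFading

end
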